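/-
Copyright: the b2b-balaban cell (near-miss cell 7), T⁴-continuum fan-out, round-2 swarm seat t4-ne7b-formalise-leaf-09
(row S3 of the lineage t4-ne7b-p1's claim table `t4/b2b-balaban-t4-ne7b-p1/LEAVES-NE7b.md`; node U5c COUNT member).
Released under the licence of the surrounding project.
-/
import Summits.QuantumFields.BalabanUV.T4Continuum.Support.HistoryChain

/-!
# History genealogies, part 2: the genealogy of a component read off its pedigree

Summits-side support leaf of the T⁴-continuum cell (rung (B)+1 on a FINITE torus only; NOT infinite volume, NOT the
mass gap, NOT the Clay statement; NOT a proof of the spine estimate NE7b).  Round-2 swarm `t4-ne7b-formalise-*`, row S3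
«H2a the genealogy of a live component» (claim table `t4/b2b-balaban-t4-ne7b-p1/LEAVES-NE7b.md`, seat leaf-09); part 2
of 3 (part 1 `Support/HistoryChain.lean`; part 3 instantiates on row S1's `AdmissibleHistory`).  [folklore] finite
bookkeeping over the lineage's OWN carrier; nothing is quoted from print, nothing printed is asserted; no `[cite:]` tag.

WHAT.  The COMBINATORIAL SKELETON of an admissible history and the genealogy it determines, generic in a type `α` of
component names and a payload type `π` (the supplier's record of a new region):
* `Part α π` — a part of a component one step later: an OLD component continued (`old c′ false`) or RENEWED
  (`old c′ true`; B16 p. 386 ll. 1–3, READ), or a NEW region of class `d′` with payload (`new d′ x`; (1.79), READ);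
  `Pedigree α π` — `step`, the LIST of parts of every component (older line first), old parts of earlier steps;
* `Tag α π` ∕ `Lab α π = PEv × Tag α π` — every event carries the dictionary shape `(step, kind, class)` AND a tag naming
  it (birth of the `i`-th part of `c` with its class and payload; renewal of the `i`-th part of `c`; `i`-th merger of
  `c`'s chain): tags make events distinct for free and carry the regions; the shape map is `Prod.fst`;
* **`Pedigree.genT c : Gen (Lab α π)`** — the TAGGED genealogy (well-founded recursion on the step; `genT_eq`): the part
  genealogies (`partGen`: `born ((step c,0,d′), …) (step c)` ∕ the old line ∕ `renew (old line) ((step c,1,0), …)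
  (step c′)`) joined by the merger chain of part 1 with events `((step c,2,0), mer c i)` — kinds 1∕2 carry class `0`
  (the one-label menus; row S12's table constraint); **`Pedigree.gen c : Gen PEv := gmap Prod.fst (genT c)`** — the FLAT
  genealogy the cell-tagged socket `HistorySocketTagged.LiveHistoriesT` consumes;
* the API the rows S4–S7 read: `rootStep_genT` (= the minimal root step of the parts, print's `j(Z)`),
  `rootStep_genT_le`, `rootStep∕root_join_of_head_le`, `reach_part_le_genT`, `mem_events_genT`, `rootStep∕root∕reach∕
  events_gen`, and **`staged_genT` ∕ `staged_gen` ∕ `chrono_gen`**: the genealogy is assembled STEP BY STEP (births at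
  their step, renewal events dated at the renewed component's step, the mergers of the operations of step `s` dated `s`
  over structures staged at `s`), hence `HistoryChrono.Staged` at the component's step and `ZoneSkeleton.Chrono` (row
  S5's binder of the zone count, by `HistoryChrono`).

NOT DONE HERE.  Consistency ∕ well-formedness ∕ pendency of `gen c` for the run's window table (row S4: needs the
supplier's TIMING facts and the displayed restriction `TypeNodup ∧ RenewAtReach` of the owner's ruling, LEAVES-NE7b.md
v1.5 — the flat events of ONE genealogy must be distinct), zones (S6), slots (S7); the instantiation `liveGen h X` on
row S1's structure (part 3).  Nothing of Bałaban's is constructed or asserted.  NE7b discharge: no date.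

HONEST DEPENDENCY (cell): continuum YM on T⁴ ⇐ BetaPertH ∧ nine spine estimates (0/9 proved); BetaPertH ⇐ (D1) ∧ (D4)
∧ CAP+tail.  This file changes none of it.
-/

open Finset
open Literature.MathematicalPhysics.QuantumFieldTheory.Balaban1983to89
open T4PersistenceDictionary
open Summit.QuantumFields.BalabanUV.T4Continuum.ZoneSkeleton
open Summit.QuantumFields.BalabanUV.T4Continuum.HistoryChrono
open Summit.QuantumFields.BalabanUV.T4Continuum.LateMergers

namespace Summit.QuantumFields.BalabanUV.T4Continuum.HistoryGen

/-! ## §1 Pedigrees and the genealogy of a component -/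

section Pedigree

/-- **A PART of a component** `Z` of the large-field region of some step `s` (B16 p. 386, the two cases of the inductive
description, READ — nothing asserted): `old c′ false` — a component `c′` of the previous step continued with no new
field (`Z ⊇ S(Z₀)`); `old c′ true` — a component `c′` of the previous step, READY at its step, RENEWED by a new large
field of the preparatory operations (p. 386 ll. 1–3); `new d′` — a NEW large-field region of fatness class `d′`
created at step `s` ((1.79)), with a PAYLOAD `x : π` (the supplier's record of the region — its cube family, its
anchor; nothing here reads it).  A component with one part is the first case (or a fresh region); with several parts,
the second case (a merger). [folklore] -/
inductive Part (α π : Type*) : Type _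
  | old (c : α) (renewed : Bool) : Part α π
  | new (d : ℕ) (x : π) : Part α π
  deriving DecidableEq

/-- **THE PEDIGREE** of the components of a history: every component name `c : α` has its step `step c` and the LIST
`parts c` of its parts (older line first, by convention of the supplier); an old part is a component of a STRICTLY
EARLIER step (in print: of the previous step).  Nothing else is asked here — forest-ness, non-emptiness, timing are the
supplier's well-formedness facts, used by the rows that need them. [folklore] -/
structure Pedigree (α π : Type*) where
  /-- the step of a component -/
  step : α → ℕ
  /-- the parts of a component, older line first -/
  parts : α → List (Part α π)
  /-- old parts are components of an earlier step -/
  step_lt : ∀ c c' r, Part.old c' r ∈ parts c → step c' < step c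

/-- **EVENT TAGS**: the `i`-th part of `c` born (a new region of class `d′` with payload `x`), the `i`-th part of `c`
renewed (an old ready component), the `i`-th binary merger of `c`'s chain.  Tags name events injectively across
components and parts, and a birth tag CARRIES the region's record. [folklore] -/
inductive Tag (α π : Type*) : Type _
  | birth (c : α) (i : ℕ) (d : ℕ) (x : π) : Tag α π
  | ren (c : α) (i : ℕ) : Tag α π
  | mer (c : α) (i : ℕ) : Tag α π
  deriving DecidableEq

/-- **TAGGED LABELS**: a dictionary event `(step, kind, d′) : PEv` together with its tag; the shape map is `Prod.fst`.
[folklore] -/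
abbrev Lab (α π : Type*) : Type _ := PEv × Tag α π

variable {α π : Type*}

namespace Pedigree

variable (P : Pedigree α π)

/-- **THE GENEALOGY OF A PART** of `c`, given the genealogies `rec` of earlier components: a new region of class `d′` is
`born ((step c, 0, d′), birth c i d′ x) (step c)`; an old part continued is its own genealogy; an old part renewed is
`renew (rec c′) ((step c, 1, 0), ren c i) (step c′)` — ready at ITS step, the renewed component a domain of step
`step c` (the dictionary's convention: event step `h + 1`, readiness step `h`). [folklore] -/
def partGen (c : α) (rec : α → Gen (Lab α π)) (i : ℕ) : Part α π → Gen (Lab α π)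
  | Part.new d x => Gen.born (((P.step c, 0, d) : PEv), Tag.birth c i d x) (P.step c)
  | Part.old c' false => rec c'
  | Part.old c' true => Gen.renew (rec c') (((P.step c, 1, 0) : PEv), Tag.ren c i) (P.step c')

/-- the part genealogies of a list of parts, the `k`-th list entry tagged `i + k` [folklore] -/
def partsGenAux (c : α) (rec : α → Gen (Lab α π)) : ℕ → List (Part α π) → List (Gen (Lab α π))
  | _, [] => []
  | i, p :: ps => P.partGen c rec i p :: partsGenAux c rec (i + 1) ps

/-- **THE PART GENEALOGIES** of `c` [folklore] -/
def partsGen (c : α) (rec : α → Gen (Lab α π)) : List (Gen (Lab α π)) := P.partsGenAux c rec 0 (P.parts c)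

/-- the `i`-th merger label of `c`: shape `(step c, 2, 0)` [folklore] -/
def merLab (c : α) (i : ℕ) : Lab α π := (((P.step c, 2, 0) : PEv), Tag.mer c i)

/-- **JOINING THE PARTS** by the binary-merger chain at the step of `c` (§1); a component with no part — not a
component of any history — gets a harmless junk value. [folklore] -/
def join (c : α) : List (Gen (Lab α π)) → Gen (Lab α π)
  | [] => Gen.born (((P.step c, 0, 0) : PEv), Tag.mer c 0) (P.step c)
  | G :: Gs => chainMerge G Gs (P.merLab c)

/-- **THE TAGGED GENEALOGY OF A COMPONENT** (B16 pp. 384–387 READ onto the ledger `T4PersistenceDictionary.Gen`): the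
part genealogies joined by the merger chain; well-founded recursion on the step (old parts are of earlier steps —
the guard `step c′ < step c` is always met on parts, `genT_eq`). [folklore] -/
def genT (c : α) : Gen (Lab α π) :=
  P.join c (P.partsGen c fun c' =>
    if _h : P.step c' < P.step c then genT c' else Gen.born (((P.step c, 0, 0) : PEv), Tag.mer c 0) (P.step c))
termination_by P.step c
decreasing_by exact _h

/-- **THE (FLAT) GENEALOGY OF A COMPONENT**: the tagged genealogy with the tags forgotten. [folklore] -/
def gen (c : α) : Gen PEv := gmap Prod.fst (P.genT c)

/-! ### unfolding -/

variable {P}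

/-- part genealogies depend on `rec` only through the old parts listed [folklore] -/
theorem partsGenAux_congr (c : α) {rec rec' : α → Gen (Lab α π)} :
    ∀ (i : ℕ) (ps : List (Part α π)), (∀ c' r, Part.old c' r ∈ ps → rec c' = rec' c') →
      P.partsGenAux c rec i ps = P.partsGenAux c rec' i ps
  | _, [], _ => rfl
  | i, p :: ps, h => by
      rw [partsGenAux, partsGenAux, partsGenAux_congr c (i + 1) ps fun c' r hm => h c' r (List.mem_cons_of_mem _ hm)]
      congr 1
      rcases p with ⟨c', _ | _⟩ | ⟨d, x⟩
      · exact h c' false List.mem_cons_self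
      · simp only [partGen]; rw [h c' true List.mem_cons_self]
      · rfl

variable (P)

/-- **UNFOLDING**: the tagged genealogy of `c` is the join of its part genealogies, the old parts carrying THEIR tagged
genealogies. [folklore] -/
theorem genT_eq (c : α) : P.genT c = P.join c (P.partsGen c P.genT) := by
  rw [genT]
  unfold partsGen
  rw [partsGenAux_congr c 0 (P.parts c) fun c' r hm => dif_pos (P.step_lt c c' r hm)]

/-! ### the part genealogies -/

/-- the part list keeps its length [folklore] -/
@[simp] theorem length_partsGenAux (c : α) (rec : α → Gen (Lab α π)) :
    ∀ (i : ℕ) (ps : List (Part α π)), (P.partsGenAux c rec i ps).length = ps.length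
  | _, [] => rfl
  | i, p :: ps => by rw [partsGenAux, List.length_cons, List.length_cons, length_partsGenAux c rec (i + 1) ps]

/-- the number of part genealogies is the number of parts [folklore] -/
@[simp] theorem length_partsGen (c : α) (rec : α → Gen (Lab α π)) :
    (P.partsGen c rec).length = (P.parts c).length := P.length_partsGenAux c rec 0 _

/-- part genealogies of a cons [folklore] -/
@[simp] theorem partsGenAux_cons (c : α) (rec : α → Gen (Lab α π)) (i : ℕ) (p : Part α π) (ps : List (Part α π)) :
    P.partsGenAux c rec i (p :: ps) = P.partGen c rec i p :: P.partsGenAux c rec (i + 1) ps := rfl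

/-- part genealogies of the empty list [folklore] -/
@[simp] theorem partsGenAux_nil (c : α) (rec : α → Gen (Lab α π)) (i : ℕ) : P.partsGenAux c rec i [] = [] := rfl

/-- a member of the part genealogies is the genealogy of a listed part [folklore] -/
theorem mem_partsGenAux {c : α} {rec : α → Gen (Lab α π)} {G : Gen (Lab α π)} :
    ∀ {i : ℕ} {ps : List (Part α π)}, G ∈ P.partsGenAux c rec i ps → ∃ k, ∃ p ∈ ps, G = P.partGen c rec (i + k) p
  | i, [], h => by simp at h
  | i, p :: ps, h => by
      rw [partsGenAux_cons, List.mem_cons] at h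
      rcases h with rfl | h
      · exact ⟨0, p, List.mem_cons_self, rfl⟩
      · obtain ⟨k, p', hp', rfl⟩ := mem_partsGenAux h
        exact ⟨k + 1, p', List.mem_cons_of_mem _ hp', by rw [Nat.add_assoc, Nat.add_comm 1 k]⟩

/-- root step of a part genealogy: a new region is born at the step of `c`; an old part keeps its line's root step
(a renewal does not move it). [folklore] -/
theorem rootStep_partGen (c : α) (rec : α → Gen (Lab α π)) (i : ℕ) (p : Part α π) :
    (P.partGen c rec i p).rootStep =
      match p with
      | Part.new _ _ => P.step c
      | Part.old c' _ => (rec c').rootStep := by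
  rcases p with ⟨c', _ | _⟩ | ⟨d, x⟩ <;> rfl

/-- root of a part genealogy [folklore] -/
theorem root_partGen (c : α) (rec : α → Gen (Lab α π)) (i : ℕ) (p : Part α π) :
    (P.partGen c rec i p).root =
      match p with
      | Part.new d x => (((P.step c, 0, d) : PEv), Tag.birth c i d x)
      | Part.old c' _ => (rec c').root := by
  rcases p with ⟨c', _ | _⟩ | ⟨d, x⟩ <;> rfl

/-- reach of a part genealogy: the epoch of a new region; the old reach if continued; the renewal window re-opened at
the step of `c` if renewed. [folklore] -/
theorem reach_partGen (W : Lab α π → ℕ) (c : α) (rec : α → Gen (Lab α π)) (i : ℕ) (p : Part α π) :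
    (P.partGen c rec i p).reach W =
      match p with
      | Part.new d x => P.step c + W (((P.step c, 0, d) : PEv), Tag.birth c i d x)
      | Part.old c' false => (rec c').reach W
      | Part.old c' true => P.step c' + 1 + W (((P.step c, 1, 0) : PEv), Tag.ren c i) := by
  rcases p with ⟨c', _ | _⟩ | ⟨d, x⟩ <;> rfl

/-! ### the join -/

/-- **THE MINIMAL ROOT STEP** of a list of structures, `s` for the empty list. [folklore] -/
def minRoot {ε : Type*} (s : ℕ) : List (Gen ε) → ℕ
  | [] => s
  | G :: Gs => Gs.foldl (fun m H => min m H.rootStep) G.rootStep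

/-- root step of a join = the minimal root step of the joined structures [folklore] -/
theorem rootStep_join (c : α) (L : List (Gen (Lab α π))) : (P.join c L).rootStep = minRoot (P.step c) L := by
  cases L with
  | nil => rfl
  | cons G Gs => exact rootStep_chainMerge G Gs _

/-- the join is born no later than any joined structure [folklore] -/
theorem rootStep_join_le {c : α} {L : List (Gen (Lab α π))} {G : Gen (Lab α π)} (hG : G ∈ L) :
    (P.join c L).rootStep ≤ G.rootStep := by
  cases L with
  | nil => simp at hG
  | cons H Hs =>
      rcases List.mem_cons.1 hG with rfl | hG
      · exact rootStep_chainMerge_le_head _ Hs _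
      · exact rootStep_chainMerge_le_mem _ Hs _ G hG

/-- **OLDER LINE FIRST** for the join: if the first structure is born no later than the others, the join keeps its root
step and its root. [folklore] -/
theorem rootStep_join_of_head_le {c : α} {G : Gen (Lab α π)} {Gs : List (Gen (Lab α π))}
    (h : ∀ H ∈ Gs, G.rootStep ≤ H.rootStep) : (P.join c (G :: Gs)).rootStep = G.rootStep :=
  rootStep_chainMerge_of_head_le G Gs _ h

/-- … and its root [folklore] -/
theorem root_join_of_head_le {c : α} {G : Gen (Lab α π)} {Gs : List (Gen (Lab α π))}
    (h : ∀ H ∈ Gs, G.rootStep ≤ H.rootStep) : (P.join c (G :: Gs)).root = G.root :=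
  root_chainMerge_of_head_le G Gs _ h

/-- every joined structure reaches no further than the join [folklore] -/
theorem reach_le_join (W : Lab α π → ℕ) {c : α} {L : List (Gen (Lab α π))} {G : Gen (Lab α π)} (hG : G ∈ L) :
    G.reach W ≤ (P.join c L).reach W := by
  cases L with
  | nil => simp at hG
  | cons H Hs =>
      rcases List.mem_cons.1 hG with rfl | hG
      · exact reach_head_le_chainMerge W _ Hs _
      · exact reach_mem_le_chainMerge W _ Hs _ G hG

/-! ### the genealogy of a component -/

/-- **THE ROOT STEP** of the genealogy of `c` is the minimal root step of its part genealogies («j(Z) is the index of a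
first large field region contained in Z», p. 384, READ). [folklore] -/
theorem rootStep_genT (c : α) : (P.genT c).rootStep = minRoot (P.step c) (P.partsGen c P.genT) := by
  rw [genT_eq]; exact P.rootStep_join c _

/-- the genealogy of a component is born no later than the component [folklore] -/
theorem rootStep_genT_le (c : α) : (P.genT c).rootStep ≤ P.step c := by
  rw [genT_eq]
  unfold partsGen
  cases hps : P.parts c with
  | nil => simp [join]
  | cons p ps =>
      rw [partsGenAux_cons]
      refine (P.rootStep_join_le List.mem_cons_self).trans ?_
      rcases p with ⟨c', r⟩ | ⟨d, x⟩
      · have hlt : P.step c' < P.step c := P.step_lt c c' r (by rw [hps]; exact List.mem_cons_self)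
        have ih := rootStep_genT_le c'
        rcases r with _ | _
        · exact (le_of_eq rfl).trans (ih.trans hlt.le)
        · exact (le_of_eq rfl).trans (ih.trans hlt.le)
      · exact le_of_eq rfl
termination_by P.step c

/-- every part genealogy reaches no further than the component's genealogy [folklore] -/
theorem reach_part_le_genT (W : Lab α π → ℕ) {c : α} {G : Gen (Lab α π)} (hG : G ∈ P.partsGen c P.genT) :
    G.reach W ≤ (P.genT c).reach W := by
  rw [genT_eq]; exact P.reach_le_join W hG

/-! ### the flat genealogy -/

/-- the flat genealogy has the tagged one's root step [folklore] -/
@[simp] theorem rootStep_gen (c : α) : (P.gen c).rootStep = (P.genT c).rootStep := rootStep_gmap _ _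

/-- … the shape of its root [folklore] -/
@[simp] theorem root_gen (c : α) : (P.gen c).root = (P.genT c).root.1 := root_gmap _ _

/-- … its reach for the shape-read windows [folklore] -/
@[simp] theorem reach_gen (W : PEv → ℕ) (c : α) : (P.gen c).reach W = (P.genT c).reach (W ∘ Prod.fst) :=
  reach_gmap _ _ _

/-- the flat genealogy is born no later than the component [folklore] -/
theorem rootStep_gen_le (c : α) : (P.gen c).rootStep ≤ P.step c := by
  rw [rootStep_gen]; exact P.rootStep_genT_le c

/-! ### events (decidable labels) -/

variable [DecidableEq α] [DecidableEq π]

/-- events of a part genealogy [folklore] -/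
theorem events_partGen (c : α) (rec : α → Gen (Lab α π)) (i : ℕ) (p : Part α π) :
    (P.partGen c rec i p).events =
      match p with
      | Part.new d x => {(((P.step c, 0, d) : PEv), Tag.birth c i d x)}
      | Part.old c' false => (rec c').events
      | Part.old c' true => insert (((P.step c, 1, 0) : PEv), Tag.ren c i) (rec c').events := by
  rcases p with ⟨c', _ | _⟩ | ⟨d, x⟩ <;> rfl

/-- **EVENTS OF A JOIN** of a nonempty list: the joined structures' events and the `|L| − 1` merger labels.
[folklore] -/
theorem mem_events_join {c : α} {G : Gen (Lab α π)} {Gs : List (Gen (Lab α π))} {e : Lab α π} :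
    e ∈ (P.join c (G :: Gs)).events ↔ (∃ H ∈ G :: Gs, e ∈ H.events) ∨ ∃ i < Gs.length, P.merLab c i = e := by
  change e ∈ (chainMerge G Gs (P.merLab c)).events ↔ _
  rw [mem_events_chainMerge]
  simp only [List.mem_cons, exists_eq_or_imp]
  exact or_assoc.symm

/-- **EVENTS OF THE GENEALOGY** of a component with at least one part: the parts' events and the merger labels.
[folklore] -/
theorem mem_events_genT {c : α} (hc : P.parts c ≠ []) {e : Lab α π} :
    e ∈ (P.genT c).events ↔
      (∃ H ∈ P.partsGen c P.genT, e ∈ H.events) ∨ ∃ i, i + 1 < (P.parts c).length ∧ P.merLab c i = e := by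
  rw [genT_eq]
  unfold partsGen
  cases hps : P.parts c with
  | nil => exact absurd hps hc
  | cons p ps =>
      rw [partsGenAux_cons, mem_events_join, length_partsGenAux, List.length_cons]
      simp only [Nat.add_lt_add_iff_right]

/-- … and the shapes of its events [folklore] -/
theorem events_gen (c : α) : (P.gen c).events = (P.genT c).events.image Prod.fst := events_gmap _ _


/-! ### staging: the genealogy is assembled step by step (row S5's chronology is a corollary) -/

/-- **THE TAGGED GENEALOGY OF `c` IS STAGED AT THE STEP OF `c`** (`HistoryChrono.Staged` for the date `PEv.step ∘ fst`):
births enter at their step, a renewal event is dated at the step of the renewed component, every binary merger of the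
operations of step `s` is dated `s` and joins structures staged at `s`. [folklore] -/
theorem staged_genT (c : α) : Staged (PEv.step ∘ Prod.fst) (P.step c) (P.genT c) := by
  rw [genT_eq]
  -- every part genealogy is staged at the step of `c`
  have hparts : ∀ (i : ℕ) (ps : List (Part α π)), (∀ c' r, Part.old c' r ∈ ps → P.step c' < P.step c) →
      ∀ H ∈ P.partsGenAux c P.genT i ps, Staged (PEv.step ∘ Prod.fst) (P.step c) H := by
    intro i ps hps H hH
    obtain ⟨k, p, hp, rfl⟩ := P.mem_partsGenAux hH
    rcases p with ⟨c', r⟩ | ⟨d, x⟩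
    · have hlt := hps c' r hp
      have ih := (staged_genT c').mono hlt.le
      rcases r with _ | _
      · exact ih
      · exact ih.renew (le_of_eq rfl) _
    · exact staged_born (le_of_eq rfl) _
  have hall := hparts 0 (P.parts c) (P.step_lt c)
  unfold partsGen
  cases hps : P.parts c with
  | nil => exact staged_born (le_of_eq rfl) _
  | cons p ps =>
      rw [hps] at hall
      rw [partsGenAux_cons] at hall ⊢
      exact staged_chainMerge (hall _ List.mem_cons_self) (fun H hH => hall H (List.mem_cons_of_mem _ hH))
        fun _ _ => rfl
termination_by P.step c
decreasing_by exact hlt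

/-- **THE FLAT GENEALOGY OF `c` IS STAGED AT THE STEP OF `c`** … [folklore] -/
theorem staged_gen (c : α) : Staged PEv.step (P.step c) (P.gen c) := staged_gmap Prod.fst PEv.step (P.staged_genT c)

/-- … hence CHRONOLOGICAL (`ZoneSkeleton.Chrono`, the displayed binder of the zone count; row S5). [folklore] -/
theorem chrono_gen (c : α) : Chrono PEv.step (P.gen c) := (P.staged_gen c).chrono

/-- … and all its events are dated no later than the step of `c`. [folklore] -/
theorem step_le_of_mem_events_gen (c : α) : ∀ e ∈ (P.gen c).events, PEv.step e ≤ P.step c :=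
  (P.staged_gen c).eventsLE


end Pedigree

end Pedigree

end Summit.QuantumFields.BalabanUV.T4Continuum.HistoryGen
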